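import Literature.Topology.FourManifolds.FlipContext
import Literature.Topology.FourManifolds.OneHandleStepPair
import Literature.Topology.FourManifolds.SublevelDiffeoControlled
import HarnessLib

/-!
# The flip diffeomorphism of a `1`-handle

Topic `Literature/Topology/FourManifolds` (fact seat
`provefact-Literature.Topology.FourManifolds.lauden-f709dd520c`, Laudenbach–Poénaru's Lemma 2: the
flip `H₂`, "`Φ₂(x₁) = x₁⁻¹`", p. 339).  Everything here is **proved**; no named facts.

For a flip context `C` (`FlipContext.lean`: the handle side `S` of the top critical point `p` of
index `1` and a second handle side on the rotated chart, matching condition `C.toCtx₂_match`)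
we run the handle-extension machinery of Milnor's Theorem 3.13 *keeping the description of the
result*:

* `exists_seed` — the corrected seed, here an explicit self-diffeomorphism `κ` of `M`: the
  suspension (`UnitSlab.suspDiffeomorph`) of the diffeotopy of the seed level given by the
  two-disc theorem (`OneHandleStepContext.exists_diffeotopy_discs`); `κ` preserves `f`, is the
  identity off the collar `f⁻¹(c - 2τ, c + 3τ)`, `(κ, κ⁻¹)` is a lower pair at `c + τ` and `κ`
  carries the flowed-down feet of `S` onto those of `S'` — i.e. it **exchanges** the two
  flowed-down feet discs of the handle, up to the reflection of the parameter;
* `exists_extended_pair₂` — its extension up the slab (`IsLowerPair.exists_extend`), equal to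
  `κ` below the level `c`;
* `exists_diffeomorph₂` — **the flip**: a self-diffeomorphism `Ψ` of the compact manifold `M`
  with `Ψ = id` on `{f ≤ c - 2τ}`, `f ∘ Ψ ≤ a` on `{f ≤ a}`, and on the handle region `N` (below
  `ℓ⁺ - 3δ`) `Ψ` is the chart correspondence of the two handle charts, which in the coordinates
  of `φ` is the rotation by `π`: `φ̂ (Ψ x) = rotAt (φ̂ p) (φ̂ x)` — the core of the handle is
  turned over and its feet are exchanged.

## References

* J. Milnor, *Lectures on the h-cobordism theorem* (1965), proofs of Thm. 3.4 (PDF p. 13) and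
  Thm. 3.13 (PDF pp. 18–19). [MilnorHCobordism1965]
* F. Laudenbach, V. Poénaru, Bull. Soc. Math. France 100 (1972) 337–344, proof of Lemma 2
  (pp. 339–340). [LaudenbachPoenaruBSMF1972]
-/

open scoped Manifold ContDiff Topology
open Set Function Module Metric

noncomputable section

namespace Literature.Topology.FourManifolds

open BoundaryManifold MorseChartRotate

universe u

/-! ### The inverse of the extended rotated chart -/

namespace MorseChartRotate

variable {n : ℕ} (hn : 1 ≤ n) {M : Type u} [TopologicalSpace M]
  (φ : OpenPartialHomeomorph M (EuclideanHalfSpace (n + 1))) (p : M) (R₀ : ℝ)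
  (hball : closedBall (φ.extend (𝓡∂ (n + 1)) p) R₀ ⊆ (φ.extend (𝓡∂ (n + 1))).target)

/-- **The inverse of the extended rotated chart is `φ̂⁻¹ ∘ rotAt (φ̂ p)`** on the chart ball.
[folklore] -/
theorem extend_rotateChart_symm {u : EuclideanSpace ℝ (Fin (n + 1))} (hu : u ∈ ball (φ.extend (𝓡∂ (n + 1)) p) R₀) :
    ((rotateChart hn φ p R₀ hball).extend (𝓡∂ (n + 1))).symm u =
      (φ.extend (𝓡∂ (n + 1))).symm (rotAt hn (φ.extend (𝓡∂ (n + 1)) p) u) := by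
  rw [OpenPartialHomeomorph.extend_coe_symm, comp_apply, rotateChart_symm_apply hn, rcInv,
    (𝓡∂ (n + 1)).right_inv (MorseChartReflect.ball_subset_range φ p R₀ hball hu)]

end MorseChartRotate

namespace FlipContext

variable {n : ℕ} {M : Type u} [TopologicalSpace M] [ChartedSpace (EuclideanHalfSpace (n + 1)) M]
  [IsManifold (𝓡∂ (n + 1)) ∞ M] [T2Space M] (C : FlipContext n M)

/-! ### The corrected seed, explicitly -/

/-- **The seed of the flip.**  A self-diffeomorphism `κ` of `M` preserving `f`, equal to the
identity off `f⁻¹(c - 2τ, c + 3τ)`, such that `(κ, κ⁻¹)` is a lower pair at the level `c + τ`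
of width `τ/3` carrying the flowed-down feet of `S` onto those of `S'` (on the closed unit
parameter balls): the suspension of the diffeotopy of the two-disc theorem.
[cite: MilnorHCobordism1965, proof of Thm. 3.13 (PDF pp. 18–19)] [cite: HirschDT1976, Ch. 8 §3, Thms. 3.1–3.2] -/
theorem exists_seed :
    ∃ κ : M ≃ₘ⟮𝓡∂ (n + 1), 𝓡∂ (n + 1)⟯ M,
      (∀ y, C.S.f (κ y) = C.S.f y) ∧
      (∀ y, C.S.f y ≤ C.c - 2 * C.τ ∨ C.c + 3 * C.τ ≤ C.S.f y → κ y = y) ∧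
      IsLowerPair C.toCtx₂.Sl C.toCtx₂.Sl' C.toCtx₂.σ (C.toCtx₂.c + C.toCtx₂.τ) (C.toCtx₂.τ / 3)
        (κ ∘ C.toCtx₂.g₀) (C.toCtx₂.g₀' ∘ κ.symm) ∧
      ∀ {s : ℝ} (hs : s ^ 2 = 1) (w : EuclideanSpace ℝ (Fin n)), ‖w‖ ≤ 1 → (s = 1 ∨ s = -1) →
        (κ ∘ C.toCtx₂.g₀) (C.toCtx₂.Sl.levelIncl (C.toCtx₂.Λ (C.toCtx₂.T.footLift C.toCtx₂.ρ_pos C.toCtx₂.hmR hs w))) =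
          C.toCtx₂.Sl'.levelIncl (C.toCtx₂.Λ' (C.toCtx₂.T'.footLift C.toCtx₂.ρ_pos C.toCtx₂.hmR' hs w)) := by
  obtain ⟨D₂, hP, hMm⟩ := C.toCtx₂.exists_diffeotopy_discs C.toCtx₂_match
  set κ := C.toCtx₂.Sl'.suspDiffeomorph (c := C.toCtx₂.c + C.toCtx₂.σ) C.toCtx₂.τ_pos C.toCtx₂.lo'_le C.toCtx₂.le_hi' rfl
    C.toCtx₂.hn1 D₂ with hκ
  have hτ := C.toCtx₂.τ_pos
  refine ⟨κ, fun y => ?_, fun y hy => ?_, ?_, ?_⟩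
  · exact C.toCtx₂.Sl'.apply_suspDiffeomorph C.toCtx₂.τ_pos C.toCtx₂.lo'_le C.toCtx₂.le_hi' rfl C.toCtx₂.hn1 D₂ y
  · refine C.toCtx₂.Sl'.suspDiffeomorph_eq_self C.toCtx₂.τ_pos C.toCtx₂.lo'_le C.toCtx₂.le_hi' rfl C.toCtx₂.hn1 D₂ ?_
    show C.S.f y ≤ C.c + 0 - 2 * C.τ ∨ C.c + 0 + 3 * C.τ ≤ C.S.f y
    simpa using hy
  · refine C.toCtx₂.seed.postcomp (by show 0 < C.toCtx₂.τ / 3; linarith) κ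
      (fun y => C.toCtx₂.Sl'.apply_suspDiffeomorph C.toCtx₂.τ_pos C.toCtx₂.lo'_le C.toCtx₂.le_hi' rfl C.toCtx₂.hn1 D₂ y)
      fun y t hy ht => ?_
    exact C.toCtx₂.Sl'.suspDiffeomorph_flow_of_mem C.toCtx₂.τ_pos C.toCtx₂.lo'_le C.toCtx₂.le_hi' rfl C.toCtx₂.hn1 D₂
      ⟨by linarith [hy.1], by linarith [hy.2]⟩ ⟨by linarith [ht.1], by linarith [ht.2]⟩
  · intro s hs w hw hs1
    have h2 : ∀ z : C.toCtx₂.Sl'.Level (C.toCtx₂.c + C.toCtx₂.σ),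
        κ (C.toCtx₂.Sl'.levelIncl z) = C.toCtx₂.Sl'.levelIncl (D₂.toFun 1 z) := fun z => by
      have := C.toCtx₂.Sl'.suspDiffeomorph_flow C.toCtx₂.τ_pos C.toCtx₂.lo'_le C.toCtx₂.le_hi' rfl C.toCtx₂.hn1 D₂ z (t := 0)
        ⟨by linarith [C.toCtx₂.τ_pos], by linarith [C.toCtx₂.τ_pos]⟩
      rwa [C.toCtx₂.Sl'.isFlowOf.map_zero, C.toCtx₂.Sl'.isFlowOf.map_zero] at this
    show κ (C.toCtx₂.g₀ (C.toCtx₂.Sl.levelIncl (C.toCtx₂.Λ (C.toCtx₂.T.footLift C.toCtx₂.ρ_pos C.toCtx₂.hmR hs w)))) = _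
    have h1 : C.toCtx₂.g₀ (C.toCtx₂.Sl.levelIncl (C.toCtx₂.Λ (C.toCtx₂.T.footLift C.toCtx₂.ρ_pos C.toCtx₂.hmR hs w))) =
        C.toCtx₂.Sl'.levelIncl (C.toCtx₂.Ψlev (C.toCtx₂.Λ (C.toCtx₂.T.footLift C.toCtx₂.ρ_pos C.toCtx₂.hmR hs w))) := rfl
    rw [h1, h2]
    rcases hs1 with rfl | rfl
    · exact congrArg C.toCtx₂.Sl'.levelIncl (hP w hw)
    · exact congrArg C.toCtx₂.Sl'.levelIncl (hMm w hw)

/-! ### The extension up the slab -/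

/-- **The extended pair of the flip**: the seed `κ` and a lower pair `(g, g')` at the level
`a + 2η₀`, of a width `η₀ ∈ (η/2, 2η/3]`, equal to the chart correspondence on the feet of `S`
(on the closed unit parameter balls) and to `κ` below the level `c`.
[cite: MilnorHCobordism1965, proofs of Thm. 3.4 (PDF p. 13) and Thm. 3.13 (PDF pp. 18–19)] -/
theorem exists_extended_pair₂ :
    ∃ (κ : M ≃ₘ⟮𝓡∂ (n + 1), 𝓡∂ (n + 1)⟯ M) (g g' : M → M) (η₀ : ℝ) (N : ℕ),
      (∀ y, C.S.f (κ y) = C.S.f y) ∧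
      (∀ y, C.S.f y ≤ C.c - 2 * C.τ ∨ C.c + 3 * C.τ ≤ C.S.f y → κ y = y) ∧
      C.toCtx₂.S.η / 2 < η₀ ∧ η₀ ≤ 2 * C.toCtx₂.S.η / 3 ∧
      C.toCtx₂.c + C.toCtx₂.τ + N * η₀ = C.toCtx₂.S.a + 2 * η₀ ∧
      IsLowerPair C.toCtx₂.Sl C.toCtx₂.Sl' C.toCtx₂.σ (C.toCtx₂.c + C.toCtx₂.τ + N * η₀) η₀ g g' ∧
      (∀ {s : ℝ} (hs : s ^ 2 = 1) (w : EuclideanSpace ℝ (Fin n)), ‖w‖ ≤ 1 → (s = 1 ∨ s = -1) →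
        g (C.toCtx₂.S.D.foot s C.toCtx₂.m C.toCtx₂.ρ w) = C.toCtx₂.S'.D.foot s C.toCtx₂.m' C.toCtx₂.ρ w) ∧
      ∀ x, C.S.f x < C.c → g x = κ x := by
  obtain ⟨κ, hκf, hκid, hP₁, hfeet₁⟩ := C.exists_seed
  set C₂ := C.toCtx₂ with hC₂
  have hτ := C₂.τ_pos; have hη := C₂.η_pos
  -- the arithmetic of the steps (verbatim from `OneHandleStepContext.exists_extended_pair`)
  set L : ℝ := C₂.S.a - C₂.c - C₂.τ with hL
  have hLτ : 7 * C₂.τ + 24 * C₂.S.ε ^ 2 ≤ L := by rw [hL]; linarith [C₂.c_le]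
  have hLpos : 0 < L := by linarith [sq_nonneg C₂.S.ε]
  have hLη : 2 * C₂.S.η ≤ L := by linarith [C₂.hητ, sq_nonneg C₂.S.ε]
  set q : ℝ := 3 * L / (2 * C₂.S.η) with hq
  have hqpos : 0 < q := by rw [hq]; positivity
  set N' : ℕ := ⌈q⌉₊ with hN'
  have hN'q : q ≤ N' := Nat.le_ceil q
  have hN'lt : (N' : ℝ) < q + 1 := Nat.ceil_lt_add_one hqpos.le
  have hN'pos : (0 : ℝ) < N' := lt_of_lt_of_le hqpos hN'q
  set η₀ : ℝ := L / N' with hη₀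
  have hη₀pos : 0 < η₀ := div_pos hLpos hN'pos
  have hη₀le : η₀ ≤ 2 * C₂.S.η / 3 := by
    rw [hη₀, div_le_iff₀ hN'pos]
    have : 3 * L / (2 * C₂.S.η) * (2 * C₂.S.η / 3) = L := by field_simp
    nlinarith
  have hη₀gt : C₂.S.η / 2 < η₀ := by
    rw [hη₀, lt_div_iff₀ hN'pos]
    have : (q + 1) * (C₂.S.η / 2) ≤ L := by
      rw [hq]
      have : 3 * L / (2 * C₂.S.η) * (C₂.S.η / 2) = 3 * L / 4 := by field_simp; ring
      nlinarith
    nlinarith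
  set N : ℕ := N' + 2 with hN
  have hNη₀ : (N : ℝ) * η₀ = L + 2 * η₀ := by
    rw [hN]; push_cast
    have : (N' : ℝ) * η₀ = L := by rw [hη₀]; field_simp
    linarith [this]
  have hA : C₂.c + C₂.τ + N * η₀ = C₂.S.a + 2 * η₀ := by rw [hNη₀, hL]; ring
  -- the extension
  have hlo : C₂.Sl.lo ≤ C₂.c - C₂.τ := by show C₂.S.ℓ₁ ≤ _; rw [C₂.hℓ₁_eq]; linarith
  have hlo' : C₂.Sl'.lo ≤ C₂.c + C₂.σ - C₂.τ := by show C₂.S'.ℓ₁ ≤ _; rw [C₂.hℓ₁, C₂.hℓ₁_eq]; linarith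
  have hhi : C₂.c + C₂.τ + C₂.τ / 3 ≤ C₂.Sl.hi := by
    show _ ≤ C₂.S.a + 2 * C₂.S.η; linarith [C₂.c_le, sq_nonneg C₂.S.ε]
  have hhi' : C₂.c + C₂.σ + C₂.τ + C₂.τ / 3 ≤ C₂.Sl'.hi := by
    show _ ≤ C₂.S'.a + 2 * C₂.S'.η; rw [C₂.ha, C₂.hη]; linarith [C₂.c_le, sq_nonneg C₂.S.ε]
  have hη₀τ : 18 * η₀ ≤ 5 * C₂.τ := by linarith [C₂.hητ]
  have hNhi : C₂.c + C₂.τ + N * η₀ ≤ C₂.Sl.hi := by show _ ≤ C₂.S.a + 2 * C₂.S.η; rw [hA]; linarith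
  have hNhi' : C₂.c + C₂.σ + C₂.τ + N * η₀ ≤ C₂.Sl'.hi := by
    show _ ≤ C₂.S'.a + 2 * C₂.S'.η; rw [C₂.ha, C₂.hη]; linarith [hA]
  obtain ⟨g, g', hP, hbelow, -, hconj⟩ := IsLowerPair.exists_extend hτ hP₁ hlo hlo' hhi hhi' hη₀pos hη₀τ N hNhi hNhi'
  refine ⟨κ, g, g', η₀, N, hκf, hκid, hη₀gt, hη₀le, hA, hP, fun {s} hs w hw hs1 => ?_, fun x hx => hbelow x hx⟩
  -- the feet (verbatim from `OneHandleStepContext.exists_extended_pair`)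
  have hfv : C₂.S.f (C₂.S.D.foot s C₂.m C₂.ρ w) = C₂.S.f C₂.S.p - C₂.m := C₂.T.apply_foot C₂.ρ_pos C₂.hmR hs w
  have h1 := hconj (C₂.S.D.foot s C₂.m C₂.ρ w) (by show C₂.c ≤ C₂.S.f _; rw [hfv, C₂.fp_sub_m]; linarith [C₂.c_le, sq_nonneg C₂.S.ε])
    (by show C₂.S.f _ < _; rw [hfv, C₂.fp_sub_m, hA]; linarith)
  rw [show C₂.Sl.f (C₂.S.D.foot s C₂.m C₂.ρ w) = C₂.S.f C₂.S.p - C₂.m from hfv] at h1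
  rw [h1]
  have h2 : C₂.Sl.θ (C₂.c - (C₂.S.f C₂.S.p - C₂.m), C₂.S.D.foot s C₂.m C₂.ρ w) =
      C₂.Sl.levelIncl (C₂.Λ (C₂.T.footLift C₂.ρ_pos C₂.hmR hs w)) := rfl
  rw [h2, hfeet₁ hs w hw hs1]
  show C₂.S'.θ (C₂.S.f C₂.S.p - C₂.m - C₂.c, C₂.S'.θ (C₂.c + C₂.σ - (C₂.S'.f C₂.S'.p - C₂.m'), C₂.S'.D.foot s C₂.m' C₂.ρ w)) = _
  rw [C₂.S'.isFlowOf.map_add, C₂.fp_sub_m, C₂.fp_sub_m', C₂.ha, show C₂.S.a - C₂.c + (C₂.c + C₂.σ - (C₂.S.a + C₂.σ)) = 0 by ring,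
    C₂.S'.isFlowOf.map_zero]

/-! ### The flip diffeomorphism -/

set_option maxHeartbeats 1600000 in
/-- **The flip diffeomorphism.**  A self-diffeomorphism `Ψ` of the compact manifold `M` which
is the identity on `{f ≤ c - 2τ}`, maps `{f ≤ a}` into itself, and on the handle region `N`
below `ℓ⁺ - 3δ` is the chart correspondence of the two handle charts — in the coordinates of
`φ`, the rotation by `π` about `φ̂ p`. [cite: MilnorHCobordism1965, proof of Thm. 3.13 (PDF pp. 18–19)]
[cite: LaudenbachPoenaruBSMF1972, proof of Lemma 2 (p. 340)] -/
theorem exists_diffeomorph₂ [CompactSpace M] :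
    ∃ Ψ : M ≃ₘ⟮𝓡∂ (n + 1), 𝓡∂ (n + 1)⟯ M,
      (∀ x, C.S.f x ≤ C.c - 2 * C.τ → Ψ x = x) ∧
      (∀ x, C.S.f x ≤ C.S.a → C.S.f (Ψ x) ≤ C.S.a) ∧
      (∀ x ∈ C.S.N, C.S.f x ≤ C.S.ℓu - 3 * C.S.δ → Ψ x = C.S.D.chartMap C.D' x) ∧
      ∀ x ∈ C.S.N, C.S.f x ≤ C.S.ℓu - 3 * C.S.δ →
        Ψ x = (C.φ.extend (𝓡∂ (n + 1))).symm (rotAt C.hn1 (C.φ.extend (𝓡∂ (n + 1)) C.S.p) (C.φ.extend (𝓡∂ (n + 1)) x)) := by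
  obtain ⟨κ, g, g', η₀, N, hκf, hκid, hη₀, hη₀', hA, hP, hfeet, hbelow⟩ := C.exists_extended_pair₂
  set P := C.toCtx₂.pair hη₀ hη₀' hA hP hfeet with hPdef
  have hε := C.S.ε_pos; have hη := C.S.η_pos; have hδ := C.S.δ_pos; have hτ := C.τ_pos
  have hσ : P.σ = 0 := by show C.S.f C.S.p - C.S.f C.S.p = 0; ring
  have hPf : P.S.f = C.S.f := rfl
  have hc_le : C.c + 8 * C.τ ≤ C.S.a - 24 * C.S.ε ^ 2 := by
    have := C.toCtx₂.c_le; simpa only [toCtx₂_c, toCtx₂_τ, toCtx₂_S] using this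
  -- the top level `b = ℓ⁺ - 2δ` and regularity above it (as in `nonempty_diffeomorph`)
  set b : ℝ := C.S.ℓu - 2 * C.S.δ with hb
  have hregb : ∀ x, b ≤ P.S.f x → mfderiv (𝓡∂ (n + 1)) 𝓘(ℝ, ℝ) P.S.f x ≠ 0 := by
    intro x hx
    have hx' : C.S.ℓu - 2 * C.S.δ ≤ C.S.f x := hx
    rw [C.hℓu_eq, C.hδ_eq] at hx'
    have hxp : x ≠ C.S.p := fun h => by rw [h] at hx'; nlinarith
    exact C.hreg x (by have := C.hcτ; nlinarith [C.τ_pos]) hxp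
  have hbd : ∀ x ∈ (𝓡∂ (n + 1)).boundary M, P.S.f x = 1 := fun x hx => (C.hF.2.1 x hx).1
  have hlt : ∀ x ∈ (𝓡∂ (n + 1)).interior M, P.S.f x < 1 := fun x hx => C.hF.2.2 x hx
  have hb1 : b < 1 := by rw [hb, C.hℓu_eq, C.hδ_eq]; have := C.htop; nlinarith
  have hb₁ : P.S.a + P.S.η ≤ b := by
    show C.S.a + C.S.η ≤ b; rw [hb, C.ha_eq, C.hℓu_eq, C.hδ_eq]; have := C.hηε; nlinarith
  have hb₂ : b ≤ P.S.ℓu - 2 * P.S.δ := le_rfl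
  have hint : ∀ p, P.S.f p ≤ b → (𝓡∂ (n + 1)).IsInteriorPoint p := fun p hp =>
    ((𝓡∂ (n + 1)).isInteriorPoint_or_isBoundaryPoint p).resolve_right fun hb' => by
      have := hbd p hb'; linarith
  have hreg' : ∀ p, P.S.f p = b → ¬ IsMCriticalPt (𝓡∂ (n + 1)) P.S.f p := fun p hp hc => hregb p hp.ge hc
  have hregbσ : ∀ x, b + P.σ ≤ P.S'.f x → mfderiv (𝓡∂ (n + 1)) 𝓘(ℝ, ℝ) P.S'.f x ≠ 0 := fun x hx =>
    hregb x (by rw [hσ, add_zero] at hx; exact hx)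
  have hb1σ : b + P.σ < 1 := by rw [hσ, add_zero]; exact hb1
  have hintσ : ∀ p, P.S'.f p ≤ b + P.σ → (𝓡∂ (n + 1)).IsInteriorPoint p := fun p hp =>
    hint p (by rw [hσ, add_zero] at hp; exact hp)
  have hregσ' : ∀ p, P.S'.f p = b + P.σ → ¬ IsMCriticalPt (𝓡∂ (n + 1)) P.S'.f p := fun p hp =>
    hreg' p (by rw [hσ, add_zero] at hp; exact hp)
  letI csb := (sublevelAtlas P.S.hf b hint hreg').chartedSpace
  letI csb' := (sublevelAtlas P.S'.hf (b + P.σ) hintσ hregσ').chartedSpace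
  -- the handle-extension diffeomorphism of the sublevel sets
  set Φ := P.diffeomorphSublevel C.toCtx₂.hn1 hb₁ hb₂ hint hreg' hintσ hregσ' with hΦ
  -- the two pushes, each the identity below `b - δ`, `b + P.σ - δ`
  obtain ⟨amax, hamax, ha⟩ := exists_diffeomorph_sublevel_apply_eq_eq_self C.toCtx₂.hn1 P.S.hf hbd hlt hb1 hregb hint hreg' hδ
  obtain ⟨amax', hamax', ha'⟩ := exists_diffeomorph_sublevel_apply_eq_eq_self C.toCtx₂.hn1 P.S'.hf hbd hlt hb1σ hregbσ hintσ hregσ' hδ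
  obtain ⟨G, -, -, -, hGid⟩ := ha amax hamax le_rfl
  obtain ⟨G', -, -, -, hG'id⟩ := ha' amax' hamax' le_rfl
  -- `Ψ = hetMap` on the deep part
  have hΨ : ∀ x, C.S.f x ≤ C.S.ℓu - 3 * C.S.δ → (G.trans (Φ.trans G'.symm)) x = P.hetMap x := by
    intro x hx
    have hxb : C.S.f x ≤ b - C.S.δ := by rw [hb]; linarith
    have hxb' : C.S.f x ≤ b := by linarith
    have hGx : (G x).1 = x := hGid x hxb
    have hGx' : G x = ⟨x, hxb'⟩ := Subtype.ext hGx
    have hlev : C.S.f (P.hetMap x) ≤ b + P.σ - C.S.δ := by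
      rcases lt_or_ge (C.S.a - C.S.η / 2) (C.S.f x) with h | h
      · have h' : C.S.f (P.hetMap x) = C.S.f x + P.σ := P.apply_hetMap h (by show C.S.f x ≤ C.S.ℓu; linarith)
        linarith
      · have hlt' : C.S.f x < C.S.a + C.S.η / 2 := by linarith
        rw [P.hetMap_eq_low hlt']
        have h2 : C.S.f (P.low x) < C.S.a - C.S.η / 4 := P.low_below x (by show C.S.f x < C.S.a - C.S.η / 4; linarith)
        rw [hσ, hb, C.ha_eq, C.hℓu_eq, C.hδ_eq] at *
        nlinarith [C.hηε]
    have hlev' : C.S.f (P.hetMap x) ≤ b + P.σ := by linarith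
    have hy : (G' (P.hetMap x)).1 = P.hetMap x := hG'id _ hlev
    have hy' : G' (P.hetMap x) = ⟨P.hetMap x, hlev'⟩ := Subtype.ext hy
    show G'.symm (Φ (G x)) = P.hetMap x
    rw [hGx']
    have hΦx : Φ ⟨x, hxb'⟩ = ⟨P.hetMap x, hlev'⟩ :=
      Subtype.ext (P.diffeomorphSublevel_apply C.toCtx₂.hn1 hb₁ hb₂ hint hreg' hintσ hregσ' _)
    rw [hΦx, ← hy', Diffeomorph.symm_apply_apply]
  have hu3 : C.S.a ≤ C.S.ℓu - 3 * C.S.δ := by rw [C.ha_eq, C.hℓu_eq, C.hδ_eq]; nlinarith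
  have h3 : ∀ x ∈ C.S.N, C.S.f x ≤ C.S.ℓu - 3 * C.S.δ → (G.trans (Φ.trans G'.symm)) x = C.S.D.chartMap C.D' x := by
    intro x hxN hx
    rw [hΨ x hx, P.hetMap_of_mem hxN]; rfl
  refine ⟨G.trans (Φ.trans G'.symm), fun x hx => ?_, fun x hx => ?_, h3, fun x hxN hx => ?_⟩
  · -- the identity below `c - 2τ`: `hetMap = low = g = κ = id`
    have hxc : C.S.f x < C.c := by linarith
    rw [hΨ x (by linarith [hu3, sq_nonneg C.S.ε]), P.hetMap_eq_low (by show C.S.f x < C.S.a + C.S.η / 2; linarith [sq_nonneg C.S.ε])]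
    have hA' : C.c + C.τ + N * η₀ = C.S.a + 2 * η₀ := hA
    have hη₀C : C.S.η / 2 < η₀ := hη₀
    have hη₀C' : η₀ ≤ 2 * C.S.η / 3 := hη₀'
    show (hP.lowerData (C.toCtx₂.η₀_pos hη₀) (C.toCtx₂.pair_hlo hη₀' hA) (C.toCtx₂.pair_hhi hη₀' hA)
      (C.toCtx₂.pair_hlo' hη₀' hA) (C.toCtx₂.pair_hhi' hη₀' hA)).low x = x
    rw [hP.low_eq (C.toCtx₂.η₀_pos hη₀) (C.toCtx₂.pair_hlo hη₀' hA) (C.toCtx₂.pair_hhi hη₀' hA)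
      (C.toCtx₂.pair_hlo' hη₀' hA) (C.toCtx₂.pair_hhi' hη₀' hA)
      (by show C.S.f x ≤ C.c + C.τ + N * η₀ - 3 * η₀; have := C.hηε; nlinarith [sq_nonneg C.S.ε, C.S.ε_pos]), hbelow x hxc]
    exact hκid x (Or.inl hx)
  · -- `{f ≤ a}` is mapped into itself
    rw [hΨ x (hx.trans hu3)]
    have := P.apply_hetMap_le (b := C.S.a) le_rfl (by show C.S.a ≤ C.S.ℓu; linarith) hx
    rw [hσ, add_zero] at this
    exact this
  · -- the chart correspondence in the coordinates of `φ`: the rotation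
    rw [h3 x hxN hx, show C.S.D.chartMap C.D' x =
      (C.D'.chart.extend (𝓡∂ (n + 1))).symm (C.D'.chart.extend (𝓡∂ (n + 1)) C.S.p + C.S.D.coord x) from rfl]
    have hxb := C.S.N_subset_cball hxN
    have hcoord : C.S.D.coord x = C.φ.extend (𝓡∂ (n + 1)) x - C.φ.extend (𝓡∂ (n + 1)) C.S.p := by
      show C.S.D.chart.extend (𝓡∂ (n + 1)) x - C.S.D.chart.extend (𝓡∂ (n + 1)) C.S.p = _; rw [C.hDe, C.hDe]
    have hnorm : ‖C.φ.extend (𝓡∂ (n + 1)) x - C.φ.extend (𝓡∂ (n + 1)) C.S.p‖ < 3 * C.S.ε := by rw [← hcoord]; exact hxb.2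
    have hu : C.φ.extend (𝓡∂ (n + 1)) x ∈ ball (C.φ.extend (𝓡∂ (n + 1)) C.S.p) C.R₀ := by
      rw [mem_ball, dist_eq_norm]; linarith [C.hεR]
    have huc : C.φ.extend (𝓡∂ (n + 1)) x ∈ closedBall (C.φ.extend (𝓡∂ (n + 1)) C.S.p) (3 * C.S.ε) := by
      rw [mem_closedBall, dist_eq_norm]; exact hnorm.le
    rw [C.extend_p', hcoord, add_sub_cancel]
    have hs₁ : (C.D'.chart.extend (𝓡∂ (n + 1))).source ⊆ (C.φr.extend (𝓡∂ (n + 1))).source := by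
      rw [OpenPartialHomeomorph.extend_source, OpenPartialHomeomorph.extend_source]; exact C.hDs'
    have huD : C.φ.extend (𝓡∂ (n + 1)) x ∈ (C.D'.chart.extend (𝓡∂ (n + 1))).target := by
      have h := C.hball'; rw [C.extend_p'] at h; exact h huc
    rw [MorseChartReflect.symm_eq_symm_of_forall_eq C.hDe' hs₁ huD (mem_rotateChart_extend_target C.hn1 C.φ C.S.p C.R₀ C.hballR hu)]
    exact MorseChartRotate.extend_rotateChart_symm C.hn1 C.φ C.S.p C.R₀ C.hballR hu

end FlipContext

end Literature.Topology.FourManifolds
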